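import Mathlib.Analysis.SpecialFunctions.Pow.Real
import HarnessLib

/-!
# Venture KdS — the six Vieta inequalities behind `Φ < 0` for the doubly-resonant polynomial
# candidates (STRUCTURE §8 Q3′, T10 Lemma B)

HONEST FRAMING (venture `Summits/Ventures/KdS`, cell `pub-kds`, seat P1 g11; optional object named
by LEAD g11 2026-08-23T21:07Z; companion of `RouteWDoublyResonantComparison.lean` = Lemma A).
ELEMENTARY REAL ALGEBRA on four ordered reals `r_n < 0 < r₋ < r₊ < r_c` tied to `(Λ, a², M)` by
the VIETA RELATIONS of `Δ_r = (r² + a²)(1 − Λr²/3) − 2Mr = −(Λ/3)·Π(r − r_h)`; no claim about the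
Final State Conjecture, the census records, `RouteW.NonExtremeStrata`, or the Heun bookkeeping of
the cell's note `lit/Q3PRIME-CASES.md` (LIT-1 g41, T10). It types T10 §3–§4 ("Lemma B") with
T10's letters (`n m p c` = `r_n r₋ r₊ r_c`, `A` = `a²`, `L` = `Λ`): the bundle `IsOrderedRootData`
(+ `isOrderedRootData_of_deltaR`: it holds whenever `Δ_r` FACTORS over the four ordered reals);
the objects `tOne tTwo tThree` (`T₁ T₂ T₃`), `xiL` (`Ξ`), `deltaRDerivPlus` (`Δ_r′(r₊)` as a root
product), `kappaPlus` (`κ₊`), the six coefficients `cUU cUI cII cU cI cOne` of T10 (4.1) (the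
stratum ratio `ϱ` and the factor `b_n` kept as free POSITIVE parameters `rho`, `b`) and `phiDR`;
the identities (I1)–(I4) and `Δ_r′(r₊) = 2r₊ − (4Λ/3)r₊³ − (2Λ/3)a²r₊ − 2M`, the bound (I5)
`Λ(r₊ + r_c)² > 1`; the SIX SIGNS and `phiDR_neg : Φ(u, i₀) < 0` for `u > 0`, `i₀ ≥ 0`
(T10 §4: `Φ ≤ C_u u + C_1 < 0`). 0 cited facts, no `sorry`; every hypothesis is displayed.
-/

namespace Summit.Ventures.KdS.RouteW.DoublyResonant

noncomputable section

/-! ### The hypothesis bundle and the objects -/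

/-- Four ordered reals `n < 0 < m < p < c` (T10: `r_n < 0 < r₋ < r₊ < r_c`) tied to `(Λ, A, M)`
(`A = a²`) by the Vieta relations of `Δ_r = (r² + A)(1 − Λr²/3) − 2Mr = −(Λ/3)·Π(r − r_h)`:
`Σ r_h = 0`, `Λ·e₂ = ΛA − 3`, `Λ·e₃ = −6M`, `Λ·e₄ = −3A`; with `Λ > 0`, `A ≥ 0`, `M ≥ 0`.
A HYPOTHESIS BUNDLE (Vieta's formulas), not a cited statement. [folklore] -/
@[folklore] structure IsOrderedRootData (L A M n m p c : ℝ) : Prop where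
  hn : n < 0
  hm : 0 < m
  hmp : m < p
  hpc : p < c
  hL : 0 < L
  hA : 0 ≤ A
  hM : 0 ≤ M
  vieta1 : n + m + p + c = 0
  vieta2 : L * (n * m + n * p + n * c + m * p + m * c + p * c) = L * A - 3
  vieta3 : L * (n * m * p + n * m * c + n * p * c + m * p * c) = -(6 * M)
  vieta4 : L * (n * m * p * c) = -(3 * A)

/-- The bundle holds whenever `Δ_r` factors over the four ordered reals (coefficient comparison
at `r = 0, ±1, ±2`). -/
theorem isOrderedRootData_of_deltaR {L A M n m p c : ℝ} (hn : n < 0) (hm : 0 < m) (hmp : m < p)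
    (hpc : p < c) (hL : 0 < L) (hA : 0 ≤ A) (hM : 0 ≤ M)
    (hΔ : ∀ r : ℝ, (r ^ 2 + A) * (1 - L * r ^ 2 / 3) - 2 * M * r =
      -(L / 3) * ((r - n) * (r - m) * (r - p) * (r - c))) :
    IsOrderedRootData L A M n m p c := by
  have h0 := hΔ 0; have h1 := hΔ 1; have h2 := hΔ (-1); have h3 := hΔ 2; have h4 := hΔ (-2)
  refine ⟨hn, hm, hmp, hpc, hL, hA, hM, ?_, ?_, ?_, ?_⟩
  · -- the `r³` coefficient: `(L/3)·e₁ = 0`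
    have : L * (n + m + p + c) = 0 := by
      linear_combination (1 / 2) * h1 - (1 / 2) * h2 - (1 / 4) * h3 + (1 / 4) * h4
    rcases mul_eq_zero.mp this with h | h
    · exact absurd h hL.ne'
    · exact h
  · linear_combination (3 / 2) * h1 + (3 / 2) * h2 - 3 * h0
  · linear_combination (-2) * h1 + 2 * h2 + (1 / 4) * h3 - (1 / 4) * h4
  · linear_combination 3 * h0

variable (L A M n m p c : ℝ)

/-- `T₁ := (Λ/3)(r₋ − r_n)(r₊ − r_c)` (T10 (3.1)). -/
def tOne : ℝ := L / 3 * (m - n) * (p - c)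

/-- `T₂ := (Λ/3)[r_n(r₊ − r_c) + r₊(r₊ + r_c)]` (T10 (3.1)). -/
def tTwo : ℝ := L / 3 * (n * (p - c) + p * (p + c))

/-- `T₃ := (Λ/3)(r₊r₋ + a²)(r₊ − r_n)(r_c − r₊)/(r₊² + a²)` (T10 (3.1)). -/
def tThree : ℝ := L / 3 * (p * m + A) * (p - n) * (c - p) / (p ^ 2 + A)

/-- `Ξ := 1 + Λa²/3`. -/
def xiL : ℝ := 1 + L * A / 3

/-- `Δ_r′(r₊)` written as the root product `(Λ/3)(r₊ − r_n)(r₊ − r₋)(r_c − r₊)`. -/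
def deltaRDerivPlus : ℝ := L / 3 * (p - n) * (p - m) * (c - p)

/-- `κ₊ := Δ_r′(r₊)/(2Ξ(r₊² + a²))` (T10 §3). -/
def kappaPlus : ℝ := deltaRDerivPlus L n m p c / (2 * xiL L A * (p ^ 2 + A))

/-- `C_ii := −(T₁ + 2T₂)` (T10 (4.1)). -/
def cII : ℝ := -(tOne L n m p c + 2 * tTwo L n p c)

/-- `C_uu := ϱ²[2(T₃ − T₂) + Ξ²a²κ₊²]` (T10 (4.1)). -/
def cUU (rho : ℝ) : ℝ :=
  rho ^ 2 * (2 * (tThree L A n m p c - tTwo L n p c) + xiL L A ^ 2 * A * kappaPlus L A n m p c ^ 2)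

/-- `C_ui := −ϱ(T₁ + 2T₂) − 2ϱ(T₂ − T₃) + b_n T₁` (T10 (4.1)). -/
def cUI (rho b : ℝ) : ℝ :=
  -rho * (tOne L n m p c + 2 * tTwo L n p c) - 2 * rho * (tTwo L n p c - tThree L A n m p c) +
    b * tOne L n m p c

/-- `C_i := 1 − α_Λ − ΛP² − T₂`, `α_Λ = Λa²/3`, `P = r₊ + r_c` (T10 (4.1)). -/
def cI : ℝ := 1 - L * A / 3 - L * (p + c) ^ 2 - tTwo L n p c

/-- `C_u := ϱ[1 − α_Λ − (2Λ/3)P² − 3(T₂ − T₃)] + 2b_n T₁` (T10 (4.1)). -/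
def cU (rho b : ℝ) : ℝ :=
  rho * (1 - L * A / 3 - 2 * L / 3 * (p + c) ^ 2 - 3 * (tTwo L n p c - tThree L A n m p c)) +
    2 * b * tOne L n m p c

/-- `C_1 := 1 − α_Λ − (2Λ/3)P² − 2T₂` (T10 (4.1)). -/
def cOne : ℝ := 1 - L * A / 3 - 2 * L / 3 * (p + c) ^ 2 - 2 * tTwo L n p c

/-- `Φ = C_uu u² + C_ui u i₀ + C_ii i₀² + C_u u + C_i i₀ + C_1` (T10 (4.1)). -/
def phiDR (rho b u i : ℝ) : ℝ :=
  cUU L A n m p c rho * u ^ 2 + cUI L A n m p c rho b * u * i + cII L n m p c * i ^ 2 +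
    cU L A n m p c rho b * u + cI L A n p c * i + cOne L A n p c

variable {L A M n m p c}

/-! ### The identities (I1)–(I4), the derivative identity, and (I5) -/

/-- (I1): `T₁ + 2T₂ = (Λ/3)P²`. -/
theorem tOne_add_two_tTwo (h : IsOrderedRootData L A M n m p c) :
    tOne L n m p c + 2 * tTwo L n p c = L / 3 * (p + c) ^ 2 := by
  unfold tOne tTwo
  linear_combination (L / 3 * (p - c)) * h.vieta1

/-- (I2), identity part: `T₂ − T₃ = (Λ/3)[2r₊² + r₊(r₊ − r₋)(r₊ − r_n)(r_c − r₊)/(r₊² + a²)]`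
(a ring identity, no Vieta needed). -/
theorem tTwo_sub_tThree (h : IsOrderedRootData L A M n m p c) :
    tTwo L n p c - tThree L A n m p c =
      L / 3 * (2 * p ^ 2 + p * (p - m) * (p - n) * (c - p) / (p ^ 2 + A)) := by
  have hX : p ^ 2 + A ≠ 0 := by have := h.hA; nlinarith [h.hm, h.hmp]
  unfold tTwo tThree
  field_simp
  ring

/-- (I2), sign part: `T₂ − T₃ > 0`, quantitatively `3(T₂ − T₃) ≥ 2Λr₊²`. -/
theorem two_L_p_sq_le (h : IsOrderedRootData L A M n m p c) :
    2 * L * p ^ 2 ≤ 3 * (tTwo L n p c - tThree L A n m p c) := by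
  rw [tTwo_sub_tThree h]
  have hX : 0 < p ^ 2 + A := by have := h.hA; nlinarith [h.hm, h.hmp]
  have hprod : 0 ≤ p * (p - m) * (p - n) * (c - p) := by
    have h1 : 0 < p := h.hm.trans h.hmp; have h2 : 0 < p - m := by linarith [h.hmp]
    have h3 : 0 < p - n := (by linarith [h.hn, h.hm]); have h4 : 0 < c - p := by linarith [h.hpc]
    positivity
  have hq : 0 ≤ p * (p - m) * (p - n) * (c - p) / (p ^ 2 + A) := div_nonneg hprod hX.le
  nlinarith [h.hL, hq]

/-- (I4): `Λa² < 3` (from `e₂ < 0`). -/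
theorem lambda_A_lt_three (h : IsOrderedRootData L A M n m p c) : L * A < 3 := by
  have hn : n = -(m + p + c) := by linarith [h.vieta1]
  have he2 : n * m + n * p + n * c + m * p + m * c + p * c < 0 := by
    rw [hn]
    nlinarith [h.hm, h.hmp, h.hpc]
  have := h.vieta2
  nlinarith [h.hL, he2, this]

/-- (I3): `ΛP² = 3 − Λ(a² + r₋² + r₋r₊) + Λr_c(r₊ − r₋)`. -/
theorem lambda_P_sq (h : IsOrderedRootData L A M n m p c) :
    L * (p + c) ^ 2 = 3 - L * (A + m ^ 2 + m * p) + L * c * (p - m) := by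
  have hn : n = -(m + p + c) := by linarith [h.vieta1]
  have h2 := h.vieta2
  rw [hn] at h2
  linear_combination (-1) * h2

/-- The two expressions of `Δ_r′(r₊)`: the root product equals the derivative of the closed form,
`(Λ/3)(r₊ − r_n)(r₊ − r₋)(r_c − r₊) = 2r₊ − (4Λ/3)r₊³ − (2Λ/3)a²r₊ − 2M`. -/
theorem deltaRDerivPlus_eq (h : IsOrderedRootData L A M n m p c) :
    deltaRDerivPlus L n m p c = 2 * p - 4 * L / 3 * p ^ 3 - 2 * L / 3 * A * p - 2 * M := by
  unfold deltaRDerivPlus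
  linear_combination (L * p ^ 2) * h.vieta1 - (2 / 3 * p) * h.vieta2 + (1 / 3) * h.vieta3

/-- `0 < Δ_r′(r₊) < 2r₊`. -/
theorem deltaRDerivPlus_pos (h : IsOrderedRootData L A M n m p c) :
    0 < deltaRDerivPlus L n m p c := by
  unfold deltaRDerivPlus
  have h1 : 0 < p - n := by linarith [h.hn, h.hm, h.hmp]
  have h2 : 0 < p - m := by linarith [h.hmp]
  have h3 : 0 < c - p := (by linarith [h.hpc]); have := h.hL
  positivity

/-- `Δ_r′(r₊) < 2r₊` (uses `M ≥ 0`). -/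
theorem deltaRDerivPlus_lt (h : IsOrderedRootData L A M n m p c) :
    deltaRDerivPlus L n m p c < 2 * p := by
  rw [deltaRDerivPlus_eq h]
  have hp : 0 < p := h.hm.trans h.hmp
  have hL := h.hL; have hA := h.hA; have hM := h.hM
  have h1 : 0 < L * p ^ 3 := by positivity
  have h2 : 0 ≤ L * A * p := by positivity
  nlinarith

/-- (I5): `Λ(r₊ + r_c)² > 1` for every four-real-root geometry (T10 §3: with `S = −e₂`,
`E = −e₄`, `EΛ² + 3SΛ = 9` and `9P⁴ − 3P²S − E > 0`). -/
theorem one_lt_lambda_P_sq (h : IsOrderedRootData L A M n m p c) : 1 < L * (p + c) ^ 2 := by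
  have hn : n = -(m + p + c) := by linarith [h.vieta1]
  have hm := h.hm; have hmp := h.hmp; have hpc := h.hpc; have hL := h.hL
  have hp : 0 < p := hm.trans hmp
  have hc : 0 < c := hp.trans hpc
  have h2 := h.vieta2
  have h4 := h.vieta4
  rw [hn] at h2 h4
  -- `S := -e₂ > 0`, `E := -e₄ > 0` (written out in `m, p, c`), and `E Λ² + 3 S Λ = 9`
  have hquad : (m + (p + c)) * m * p * c * L ^ 2 +
      3 * (m ^ 2 + m * (p + c) + (p + c) ^ 2 - p * c) * L = 9 := by
    have hA : L * A = L * (L * ((m + p + c) * m * p * c)) / 3 := by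
      have : L * A = -(L * (L * (-(m + p + c) * m * p * c))) / 3 := by rw [h4]; ring
      rw [this]; ring
    nlinarith [h2, hA]
  have hSpos : 0 < m ^ 2 + m * (p + c) + (p + c) ^ 2 - p * c := by nlinarith
  have hEpos : 0 < (m + (p + c)) * m * p * c := by
    have : 0 < m + (p + c) := by linarith
    positivity
  -- the key polynomial inequality `9P⁴ - 3P²S - E > 0` (T10: `m, p < P/2`, `pc ≤ P²/4`)
  have hkey : 0 < 9 * (p + c) ^ 4 - 3 * (p + c) ^ 2 * (m ^ 2 + m * (p + c) + (p + c) ^ 2 - p * c) -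
      (m + (p + c)) * m * p * c := by
    obtain ⟨e, he, rfl⟩ : ∃ e, 0 < e ∧ c = p + e := ⟨c - p, by linarith, by ring⟩
    -- value at `m = p` plus a nonnegative correction `(p - m)(m + p + P)(3P² + pc)`
    have hdec : 9 * (p + (p + e)) ^ 4 -
        3 * (p + (p + e)) ^ 2 * (m ^ 2 + m * (p + (p + e)) + (p + (p + e)) ^ 2 - p * (p + e)) -
        (m + (p + (p + e))) * m * p * (p + e) =
        (69 * p ^ 4 + 164 * p ^ 3 * e + 137 * p ^ 2 * e ^ 2 + 48 * p * e ^ 3 + 6 * e ^ 4) +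
        (p - m) * (m + p + (p + (p + e))) * (3 * (p + (p + e)) ^ 2 + p * (p + e)) := by
      ring
    rw [hdec]
    have h1 : 0 < 69 * p ^ 4 + 164 * p ^ 3 * e + 137 * p ^ 2 * e ^ 2 + 48 * p * e ^ 3 +
        6 * e ^ 4 := by positivity
    have h2 : 0 ≤ (p - m) * (m + p + (p + (p + e))) * (3 * (p + (p + e)) ^ 2 + p * (p + e)) := by
      have : 0 ≤ p - m := by linarith
      positivity
    linarith
  -- conclude: if `t := Λ P² ≤ 1` then `9P⁴ = E t² + 3 S t P² ≤ E + 3 S P²`, contradiction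
  by_contra hle
  push Not at hle
  have ht0 : 0 < L * (p + c) ^ 2 := by positivity
  have h9 : 9 * (p + c) ^ 4 = (m + (p + c)) * m * p * c * (L * (p + c) ^ 2) ^ 2 +
      3 * (m ^ 2 + m * (p + c) + (p + c) ^ 2 - p * c) * (L * (p + c) ^ 2) * (p + c) ^ 2 := by
    linear_combination (-(p + c) ^ 4) * hquad
  have hb1 : (m + (p + c)) * m * p * c * (L * (p + c) ^ 2) ^ 2 ≤
      (m + (p + c)) * m * p * c * (L * (p + c) ^ 2) := by
    have := mul_nonneg (mul_pos hEpos ht0).le (sub_nonneg.mpr hle)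
    nlinarith
  have hb2 : (m + (p + c)) * m * p * c * (L * (p + c) ^ 2) ≤ (m + (p + c)) * m * p * c := by
    have := mul_nonneg hEpos.le (sub_nonneg.mpr hle)
    nlinarith
  have hb3 : 3 * (m ^ 2 + m * (p + c) + (p + c) ^ 2 - p * c) * (L * (p + c) ^ 2) * (p + c) ^ 2 ≤
      3 * (m ^ 2 + m * (p + c) + (p + c) ^ 2 - p * c) * (p + c) ^ 2 := by
    have hSP : 0 < 3 * (m ^ 2 + m * (p + c) + (p + c) ^ 2 - p * c) * (p + c) ^ 2 := by
      positivity
    have := mul_nonneg hSP.le (sub_nonneg.mpr hle)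
    nlinarith
  linarith

/-! ### The six signs (T10 §4) -/

/-- `C_ii < 0` (by (I1)). -/
theorem cII_neg (h : IsOrderedRootData L A M n m p c) : cII L n m p c < 0 := by
  unfold cII
  rw [tOne_add_two_tTwo h]
  have hP : 0 < p + c := by linarith [h.hm, h.hmp, h.hpc]
  have := h.hL; have : 0 < L / 3 * (p + c) ^ 2 := by positivity
  linarith

/-- `T₁ < 0`. -/
theorem tOne_neg (h : IsOrderedRootData L A M n m p c) : tOne L n m p c < 0 := by
  unfold tOne
  have h1 : 0 < m - n := (by linarith [h.hn, h.hm]); have h2 : p - c < 0 := by linarith [h.hpc]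
  have := h.hL; have : 0 < L / 3 * (m - n) := by positivity
  exact mul_neg_of_pos_of_neg this h2

/-- `T₂ > 0`, quantitatively `T₂ ≥ (2Λ/3) r₊²` (T10 §4, proof of `C_1 < 0`). -/
theorem two_L_p_sq_le_tTwo (h : IsOrderedRootData L A M n m p c) :
    2 * L / 3 * p ^ 2 ≤ tTwo L n p c := by
  unfold tTwo
  have hp : 0 < p := h.hm.trans h.hmp
  have h1 : 0 ≤ n * (p - c) := by nlinarith [h.hn, h.hpc]
  have h2 : p ^ 2 ≤ p * c := by nlinarith [h.hpc]
  nlinarith [h.hL, h1, h2]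

/-- `C_ui < 0` (three negative terms: (I1), (I2), `b_n T₁ < 0`). -/
theorem cUI_neg (h : IsOrderedRootData L A M n m p c) {rho b : ℝ} (hrho : 0 < rho)
    (hb : 0 < b) : cUI L A n m p c rho b < 0 := by
  unfold cUI
  rw [tOne_add_two_tTwo h]
  have hP : 0 < p + c := by linarith [h.hm, h.hmp, h.hpc]
  have hL := h.hL
  have h1 : 0 < L / 3 * (p + c) ^ 2 := by positivity
  have h2 : 0 < tTwo L n p c - tThree L A n m p c := by
    have := two_L_p_sq_le h
    have hp : 0 < p := h.hm.trans h.hmp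
    nlinarith [pow_pos hp 2]
  have h3 := tOne_neg h
  have t1 : 0 < rho * (L / 3 * (p + c) ^ 2) := mul_pos hrho h1
  have t2 : 0 < rho * (tTwo L n p c - tThree L A n m p c) := mul_pos hrho h2
  have t3 : b * tOne L n m p c < 0 := mul_neg_of_pos_of_neg hb h3
  linarith

/-- `C_i < 0` (by (I5) and `T₂ > 0`). -/
theorem cI_neg (h : IsOrderedRootData L A M n m p c) : cI L A n p c < 0 := by
  unfold cI
  have h1 := one_lt_lambda_P_sq h
  have h2 := two_L_p_sq_le_tTwo h
  have hp : 0 < p := h.hm.trans h.hmp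
  have h3 : 0 ≤ L * A := mul_nonneg h.hL.le h.hA
  have h4 : 0 < L * p ^ 2 := mul_pos h.hL (pow_pos hp 2)
  linarith

/-- `C_1 < 0`, quantitatively `C_1 ≤ −1 + Λa²/3` (by (I3), `T₂ ≥ (2Λ/3)r₊²`, (I4)). -/
theorem cOne_neg (h : IsOrderedRootData L A M n m p c) : cOne L A n p c < 0 := by
  unfold cOne
  have h1 := lambda_P_sq h; have h2 := two_L_p_sq_le_tTwo h; have h3 := lambda_A_lt_three h
  have hL := h.hL; have hm := h.hm; have hmp := h.hmp; have hpc := h.hpc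
  -- (2Λ/3)P² ≥ 2 − (2Λ/3)(A + 2p²): from (I3) with m² + mp < 2p² and c(p − m) > 0
  have h4' : m ^ 2 + m * p ≤ 2 * p ^ 2 := by nlinarith
  have h4 : L * (m ^ 2 + m * p) ≤ 2 * L * p ^ 2 := by
    nlinarith [mul_le_mul_of_nonneg_left h4' hL.le]
  have h5 : 0 ≤ L * c * (p - m) := by
    have hc : 0 ≤ c := by linarith
    have : 0 ≤ p - m := by linarith
    positivity
  nlinarith

/-- `C_u < 0` (by (I3), `3(T₂ − T₃) ≥ 2Λr₊²`, (I4), and `b_n T₁ < 0`). -/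
theorem cU_neg (h : IsOrderedRootData L A M n m p c) {rho b : ℝ} (hrho : 0 < rho) (hb : 0 < b) :
    cU L A n m p c rho b < 0 := by
  unfold cU
  have h1 := lambda_P_sq h; have h2 := two_L_p_sq_le h; have h3 := lambda_A_lt_three h
  have hL := h.hL; have hm := h.hm; have hmp := h.hmp; have hpc := h.hpc
  have h4' : m ^ 2 + m * p ≤ 2 * p ^ 2 := by nlinarith
  have h4 : L * (m ^ 2 + m * p) ≤ 2 * L * p ^ 2 := by
    nlinarith [mul_le_mul_of_nonneg_left h4' hL.le]
  have h5 : 0 ≤ L * c * (p - m) := by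
    have hc : 0 ≤ c := by linarith
    have : 0 ≤ p - m := by linarith
    positivity
  -- the bracket is ≤ −1 + Λa²/3 − (2/3)Λ r₊² < 0
  have hbr : 1 - L * A / 3 - 2 * L / 3 * (p + c) ^ 2 -
      3 * (tTwo L n p c - tThree L A n m p c) < 0 := by
    have hp : 0 < p := hm.trans hmp
    nlinarith [pow_pos hp 2]
  have h6 := tOne_neg h
  nlinarith [mul_neg_of_pos_of_neg hrho hbr, mul_neg_of_pos_of_neg hb h6]

/-- `C_uu < 0` — the delicate one (T10 §4): `C_uu/ϱ² = −(4Λ/3)r₊² − Ξκ₊(4r₊ − Ξa²κ₊)` with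
`Ξκ₊ = Δ_r′(r₊)/(2(r₊² + a²)) < r₊/(r₊² + a²)` by `Δ_r′(r₊) < 2r₊`. -/
theorem cUU_neg (h : IsOrderedRootData L A M n m p c) {rho : ℝ} (hrho : rho ≠ 0) :
    cUU L A n m p c rho < 0 := by
  unfold cUU
  have hρ2 : 0 < rho ^ 2 := by positivity
  suffices hcore : 2 * (tThree L A n m p c - tTwo L n p c) +
      xiL L A ^ 2 * A * kappaPlus L A n m p c ^ 2 < 0 from mul_neg_of_pos_of_neg hρ2 hcore
  have hp : 0 < p := h.hm.trans h.hmp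
  have hA := h.hA; have hL := h.hL; have hX : 0 < p ^ 2 + A := by positivity
  have hΞ : 0 < xiL L A := by unfold xiL; positivity
  have hD := deltaRDerivPlus_pos h
  have hD2 := deltaRDerivPlus_lt h
  -- express everything through `D := Δ_r′(r₊)` and `X := r₊² + a²`
  have hdiff : tThree L A n m p c - tTwo L n p c =
      -(2 * L / 3 * p ^ 2) - p * deltaRDerivPlus L n m p c / (p ^ 2 + A) := by
    rw [← neg_sub, tTwo_sub_tThree h]
    unfold deltaRDerivPlus
    field_simp
    ring
  have hk : xiL L A ^ 2 * A * kappaPlus L A n m p c ^ 2 =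
      A * deltaRDerivPlus L n m p c ^ 2 / (4 * (p ^ 2 + A) ^ 2) := by
    unfold kappaPlus
    field_simp
    ring
  rw [hdiff, hk]
  -- clear denominators: multiply by 4X² > 0
  have hAX : A / (p ^ 2 + A) ≤ 1 := by
    rw [div_le_one hX]; nlinarith
  have hADX : A * deltaRDerivPlus L n m p c ^ 2 / (4 * (p ^ 2 + A) ^ 2) ≤
      p * deltaRDerivPlus L n m p c / (p ^ 2 + A) := by
    rw [div_le_div_iff₀ (by positivity) hX]
    -- A D² X ≤ 4 p D X²  ⇐  A D ≤ 4 p X  ⇐  D < 2p, A ≤ X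
    have h1 : A * deltaRDerivPlus L n m p c ≤ (p ^ 2 + A) * (2 * p) := by nlinarith
    have h2 : 0 ≤ deltaRDerivPlus L n m p c * (p ^ 2 + A) := by positivity
    have h3 := mul_le_mul_of_nonneg_left h1 h2
    have h4 : 0 ≤ p * deltaRDerivPlus L n m p c * (p ^ 2 + A) ^ 2 := by positivity
    nlinarith [h3, h4]
  have hpos2 : 0 < p * deltaRDerivPlus L n m p c / (p ^ 2 + A) := by positivity
  have hLp : 0 < L * p ^ 2 := by positivity
  linarith

/-- **Lemma B of T10: `Φ < 0`** on every stratum of every four-real-root geometry: all six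
coefficients are negative, so for `u > 0`, `i₀ ≥ 0`: `Φ ≤ C_u u + C_1 < C_1 < 0`. -/
theorem phiDR_neg (h : IsOrderedRootData L A M n m p c) {rho b u i : ℝ} (hrho : 0 < rho)
    (hb : 0 < b) (hu : 0 < u) (hi : 0 ≤ i) : phiDR L A n m p c rho b u i < 0 := by
  unfold phiDR
  have h1 := cUU_neg h hrho.ne'; have h2 := cUI_neg h hrho hb; have h3 := cII_neg h
  have h4 := cU_neg h hrho hb; have h5 := cI_neg h; have h6 := cOne_neg h
  have t1 : cUU L A n m p c rho * u ^ 2 < 0 := mul_neg_of_neg_of_pos h1 (by positivity)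
  have t2 : cUI L A n m p c rho b * u * i ≤ 0 :=
    mul_nonpos_of_nonpos_of_nonneg (mul_neg_of_neg_of_pos h2 hu).le hi
  have t3 : cII L n m p c * i ^ 2 ≤ 0 := mul_nonpos_of_nonpos_of_nonneg h3.le (by positivity)
  have t4 : cU L A n m p c rho b * u < 0 := mul_neg_of_neg_of_pos h4 hu
  have t5 : cI L A n p c * i ≤ 0 := mul_nonpos_of_nonpos_of_nonneg h5.le hi
  linarith

end

end Summit.Ventures.KdS.RouteW.DoublyResonant
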